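import Summits.Ventures.CertifiedManyBodySolver.Downfold.EmeryBlochBand
import HarnessLib

/-!
# The `t″`-fold identity of the one-band dispersion: on the nesting line `cos kx + cos ky = 0`
# a `t–t′–t″` band IS a `t–t′_eff` band with `t′_eff = t′ − 2t″`

Venture CertifiedManyBodySolver, cell `pub/hubbard-downfold` (stage S1), seat hubbard-downfold-mod-4
(technique B). Everything here is exact algebra on `Emery.oneBand` (D0 convention
`ε₁(k) = c − 2t(cos kx + cos ky) − 4t′ cos kx cos ky − 2t″(cos 2kx + cos 2ky)`), PROVED.
WHAT THIS IS NOT: a statement about any material; no number lives here.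

Why it is in the tree (the cell's OBJECT TAGS M/E, lead ruling 2026-08-26 18:45Z): a one-band box
carries object M (the MLWF hopping set `t, t′, t″, …`) and object E (a `t–t′`-only refit of the same
band near its Fermi surface), and the two `t′/t` columns differ by a factor 3–4 (La₂CuO₄: −0.07 vs
−0.26). The identity below is the kernel reason and the translation rule: since
`cos 2kx + cos 2ky = 2(cos kx + cos ky)² − 4 cos kx cos ky − 2`, the `t″` term equals a
renormalisation along the nearest-neighbour form factor `s = cos kx + cos ky` (`−4t″ s²`, vanishing
to second order at the half-filled nearest-neighbour Fermi line `s = 0`) PLUS a next-nearest-neighbour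
term of strength `−2t″`. Hence on the nesting line the band coincides with the `t–t′`-only band of
`t′_eff = t′ − 2t″` (`oneBand_eq_ttPrime_of_nesting`), and everywhere it deviates from
`(c + 4t″) − 2t·s − 4(t′ − 2t″) cos kx cos ky` by exactly `−4t″ s²` (`oneBand_sub_fold`).
Screening-grade check of record (router/INFLATION-RULES-3to1-B.md §B.10): object M
`(t′/t, t″/t) = (−0.071, +0.090)` ↦ `−0.251` vs object E `−0.259` (La₂CuO₄, run-7).
-/

namespace Summit.Ventures.CertifiedManyBodySolver.Downfold.Emery

open Real

/-- **The `t″`-fold identity** (exact): `ε₁(k) = (c + 4t″) − 2t(cos kx + cos ky)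
− 4t″(cos kx + cos ky)² − 4(t′ − 2t″) cos kx cos ky`. [folklore] -/
theorem oneBand_eq_fold (c t t' t'' kx ky : ℝ) :
    oneBand c t t' t'' kx ky =
      (c + 4 * t'') - 2 * t * (cos kx + cos ky) - 4 * t'' * (cos kx + cos ky) ^ 2
        - 4 * (t' - 2 * t'') * (cos kx * cos ky) := by
  simp only [oneBand, Real.cos_two_mul]
  ring

/-- The deviation of the `t–t′–t″` band from the folded `t–t′_eff` form (`t′_eff = t′ − 2t″`,
constant `c + 4t″`) is exactly `−4t″ (cos kx + cos ky)²` — second order in the distance from the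
nesting line. [folklore] -/
theorem oneBand_sub_fold (c t t' t'' kx ky : ℝ) :
    oneBand c t t' t'' kx ky - oneBand (c + 4 * t'') t (t' - 2 * t'') 0 kx ky =
      -4 * t'' * (cos kx + cos ky) ^ 2 := by
  rw [oneBand_eq_fold c t t' t'', oneBand_eq_fold (c + 4 * t'')]
  ring

/-- **On the nesting line** `cos kx + cos ky = 0` (the half-filled nearest-neighbour Fermi
surface) the band equals `(c + 4t″) − 4(t′ − 2t″) cos kx cos ky`: it does not see `t`, and `t″`
acts as a next-nearest-neighbour hopping of strength `−2t″`. [folklore] -/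
theorem oneBand_of_nesting {kx ky : ℝ} (h : cos kx + cos ky = 0) (c t t' t'' : ℝ) :
    oneBand c t t' t'' kx ky = (c + 4 * t'') - 4 * (t' - 2 * t'') * (cos kx * cos ky) := by
  rw [oneBand_eq_fold, h]
  ring

/-- **Object M ↦ object E on the nesting line**: there the `t–t′–t″` band (object M) coincides with
the `t–t′`-only band (object E) of ANY nearest-neighbour `t₁`, effective `t′_eff = t′ − 2t″` and
constant `c + 4t″`. [folklore] -/
theorem oneBand_eq_ttPrime_of_nesting {kx ky : ℝ} (h : cos kx + cos ky = 0)
    (c t t₁ t' t'' : ℝ) :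
    oneBand c t t' t'' kx ky = oneBand (c + 4 * t'') t₁ (t' - 2 * t'') 0 kx ky := by
  rw [oneBand_of_nesting h, oneBand_eq_fold, h]
  ring

/-- The folded next-nearest-neighbour ratio: with `t ≠ 0`,
`t′_eff / t = t′/t − 2 (t″/t)`. [folklore] -/
theorem tpEff_div (t t' t'' : ℝ) (ht : t ≠ 0) :
    (t' - 2 * t'') / t = t' / t - 2 * (t'' / t) := by
  field_simp

end Summit.Ventures.CertifiedManyBodySolver.Downfold.Emery
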